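import Literature.Algebra.EuclideanLattices.DualLatticeProofs
import Literature.NumberTheory.Automorphic.ModularLambda
import Mathlib.Analysis.Normed.Ring.InfiniteSum
import Mathlib.Analysis.InnerProductSpace.PiL2
import Mathlib.Algebra.Module.ZLattice.Covolume
import HarnessLib

/-!
# The integer lattice `ℤⁿ ⊂ ℝⁿ`: self-duality, and its theta series as powers of `θ₃`, `θ₂`

Topic `Literature/Algebra/EuclideanLattices`. The lattice `ℤⁿ` is the `ℤ`-span `Λₙ` of the
standard orthonormal basis of `EuclideanSpace ℝ (Fin n)`. Everything here is proved; no definition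
and no named fact is introduced (theta series are written out as `∑' x : Λₙ, cexp (π I τ ‖x + u‖²)`,
as in `LatticeThetaSeries.lean`).

* `tsum_prod_eq_prod_tsum` — `∑_{m ∈ ℤⁿ} ∏ᵢ Fᵢ(mᵢ) = ∏ᵢ ∑_{k ∈ ℤ} Fᵢ(k)` for absolutely convergent
  complex series (Fubini, induction on `n`);
* `mem_span_euclideanBasisFun_iff` (`x ∈ Λₙ ⟺` all coordinates are integers), `dualLattice_span_basisFun`
  (**`ℤⁿ` is self-dual**, Conway–Sloane Ch. 4 §5: `ℤⁿ` "is self-dual"), and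
  `covolume_eq_one_of_dualLattice_eq` (a self-dual lattice has covolume `1`, from the tree's
  `covolume_dualLattice_holds`), whence `covolume_span_basisFun`;
* `tsum_cexp_span_basisFun_eq_prod` — the theta series of `ℤⁿ + u` factorises over the
  coordinates, `Θ_{ℤⁿ+u}(τ) = ∏ᵢ ∑_{k ∈ ℤ} e^{πiτ(k+uᵢ)²}`;
* `tsum_cexp_span_basisFun_eq_theta3_pow` — **`Θ_{ℤⁿ}(τ) = θ₃(τ)ⁿ`** (Conway–Sloane Ch. 4 §5:
  "The theta series of `ℤⁿ` is `θ₃(z)ⁿ`"), hence `Θ_{ℤⁿ}(τ) ≠ 0` on the upper half plane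
  (`tsum_cexp_span_basisFun_ne_zero`, from the tree's `theta3_ne_zero`);
* `tsum_cexp_span_basisFun_half_eq_theta2_pow` — **`Θ_{ℤⁿ + ½𝟙}(τ) = θ₂(τ)ⁿ`** (Conway–Sloane
  Ch. 4 §5 (44) with `a = 0`: "the theta series of the translate `ℤⁿ + (0^a ½^{n-a})` is
  `θ₂(z)^{n-a} θ₃(z)^a`"), the theta series of the shift of `ℤⁿ` by half the characteristic
  vector `𝟙 = (1, …, 1)`; `norm_ones_sq` (`‖𝟙‖² = n`) and `even_sum_sub_sum_sq` (`𝟙` is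
  characteristic: `⟨𝟙, x⟩ ≡ ‖x‖²  (mod 2)` on `ℤⁿ`).

These are the `ℤⁿ`-side inputs of Elkies' theorem (`θ_L/θ₃ⁿ` and its behaviour at the cusps).

## References

* J. H. Conway, N. J. A. Sloane, *Sphere Packings, Lattices and Groups*, 3rd ed. (Springer 1999),
  Ch. 4 §4.1 (8)–(9) (`θ₂`, `θ₃`; p. 102), §5 and (44) (`Θ_{ℤⁿ} = θ₃ⁿ`, the translates, `ℤⁿ` is
  self-dual; p. 106). [ConwaySloane1999]
* N. D. Elkies, *A characterization of the `ℤⁿ` lattice*, Math. Res. Lett. 2 (1995) 321–326.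
  [Elkies1995]
-/

noncomputable section

open Complex Filter Topology Module Submodule
open scoped Real RealInnerProductSpace

namespace Literature.Algebra.EuclideanLattices

/-! ### Products of absolutely convergent series over `ℤⁿ` -/

/-- **Fubini over `ℤⁿ`**: for absolutely convergent complex series `∑_k Fᵢ(k)`, `i < n`, the
multiple series `∑_{m ∈ ℤⁿ} ∏ᵢ Fᵢ(mᵢ)` converges absolutely and equals `∏ᵢ ∑_k Fᵢ(k)` (induction
on `n`, splitting off the first coordinate, Mathlib `tsum_mul_tsum_of_summable_norm`). [folklore] -/
theorem summable_norm_prod_and_tsum_prod_eq (n : ℕ) :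
    ∀ (F : Fin n → ℤ → ℂ), (∀ i, Summable fun k => ‖F i k‖) →
      (Summable fun m : Fin n → ℤ => ‖∏ i, F i (m i)‖) ∧
        ∑' m : Fin n → ℤ, ∏ i, F i (m i) = ∏ i, ∑' k, F i k := by
  induction n with
  | zero =>
    intro F _
    refine ⟨(hasSum_unique _).summable, ?_⟩
    rw [(hasSum_unique _).tsum_eq, Fin.prod_univ_zero, Fin.prod_univ_zero]
  | succ n ih =>
    intro F hF
    obtain ⟨hs, heq⟩ := ih (fun i => F i.succ) fun i => hF i.succ
    let e : ℤ × (Fin n → ℤ) ≃ (Fin (n + 1) → ℤ) := Fin.consEquiv fun _ => ℤ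
    have key : ∀ p : ℤ × (Fin n → ℤ),
        ∏ i, F i (e p i) = F 0 p.1 * ∏ i : Fin n, F i.succ (p.2 i) := fun p => by
      rw [Fin.prod_univ_succ]
      simp only [e, Fin.consEquiv_apply, Fin.cons_zero, Fin.cons_succ]
    have hn : Summable fun p : ℤ × (Fin n → ℤ) => ‖F 0 p.1 * ∏ i : Fin n, F i.succ (p.2 i)‖ :=
      Summable.mul_norm (f := F 0) (g := fun m : Fin n → ℤ => ∏ i : Fin n, F i.succ (m i))
        (hF 0) hs
    refine ⟨(e.summable_iff (f := fun m : Fin (n + 1) → ℤ => ‖∏ i, F i (m i)‖)).mp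
      (hn.congr fun p => by simp only [Function.comp_apply, key]), ?_⟩
    rw [← e.tsum_eq, tsum_congr key,
      ← tsum_mul_tsum_of_summable_norm (f := F 0)
        (g := fun m : Fin n → ℤ => ∏ i : Fin n, F i.succ (m i)) (hF 0) hs, heq, Fin.prod_univ_succ]

/-- The corresponding summability statement without norms. [folklore] -/
theorem summable_prod_of_summable_norm {n : ℕ} {F : Fin n → ℤ → ℂ}
    (hF : ∀ i, Summable fun k => ‖F i k‖) : Summable fun m : Fin n → ℤ => ∏ i, F i (m i) :=
  (summable_norm_prod_and_tsum_prod_eq n F hF).1.of_norm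

/-- `∑_{m ∈ ℤⁿ} ∏ᵢ Fᵢ(mᵢ) = ∏ᵢ ∑_k Fᵢ(k)` for absolutely convergent complex series. [folklore] -/
theorem tsum_prod_eq_prod_tsum {n : ℕ} {F : Fin n → ℤ → ℂ}
    (hF : ∀ i, Summable fun k => ‖F i k‖) :
    ∑' m : Fin n → ℤ, ∏ i, F i (m i) = ∏ i, ∑' k, F i k :=
  (summable_norm_prod_and_tsum_prod_eq n F hF).2

/-! ### One-dimensional theta summands -/

/-- The shifted one-dimensional theta summand as a Jacobi theta term:
`e^{πiτ(k+c)²} = e^{πiτc²} · jacobiTheta₂_term k (cτ) τ`. [folklore] -/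
theorem cexp_pi_I_mul_add_sq (τ : ℂ) (c : ℝ) (k : ℤ) :
    cexp ((π : ℂ) * I * τ * (((k + c) ^ 2 : ℝ) : ℂ)) =
      cexp ((π : ℂ) * I * τ * ((c ^ 2 : ℝ) : ℂ)) * jacobiTheta₂_term k (c * τ) τ := by
  rw [jacobiTheta₂_term, ← Complex.exp_add]
  congr 1
  push_cast
  ring

/-- Absolute convergence of `∑_k e^{πiτ(k+c)²}` for `Im τ > 0`. [folklore] -/
theorem summable_norm_cexp_pi_I_mul_add_sq {τ : ℂ} (hτ : 0 < τ.im) (c : ℝ) :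
    Summable fun k : ℤ => ‖cexp ((π : ℂ) * I * τ * (((k + c) ^ 2 : ℝ) : ℂ))‖ := by
  simp_rw [cexp_pi_I_mul_add_sq τ c, norm_mul]
  exact ((summable_jacobiTheta₂_term_iff (c * τ) τ).mpr hτ).norm.mul_left _

/-- `∑_k e^{πiτk²} = θ₃(τ)` (`theta3 = jacobiTheta₂ 0`; Conway–Sloane Ch. 4 §4.1 (9)).
[cite: ConwaySloane1999, Ch. 4 §4.1 (9)] -/
theorem tsum_cexp_pi_I_mul_sq_eq_theta3 (τ : ℂ) :
    ∑' k : ℤ, cexp ((π : ℂ) * I * τ * (((k : ℝ) ^ 2 : ℝ) : ℂ)) =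
      Literature.NumberTheory.EllipticCurves.JacobiThetaNull.theta3 τ := by
  rw [Literature.NumberTheory.EllipticCurves.JacobiThetaNull.theta3, jacobiTheta₂]
  refine tsum_congr fun k => ?_
  rw [show ((k : ℝ) ^ 2 : ℝ) = ((k : ℝ) + 0) ^ 2 by rw [add_zero], cexp_pi_I_mul_add_sq]
  simp [jacobiTheta₂_term]

/-- `∑_k e^{πiτ(k+½)²} = θ₂(τ)` (`theta2 τ = e^{πiτ/4} jacobiTheta₂ (τ/2) τ`; Conway–Sloane
Ch. 4 §4.1 (8): `θ₂(z) = ∑_{m ∈ ℤ+1/2} q^{m²}`). [cite: ConwaySloane1999, Ch. 4 §4.1 (8)] -/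
theorem tsum_cexp_pi_I_mul_add_half_sq_eq_theta2 (τ : ℂ) :
    ∑' k : ℤ, cexp ((π : ℂ) * I * τ * (((k + (1 / 2 : ℝ)) ^ 2 : ℝ) : ℂ)) =
      Literature.NumberTheory.EllipticCurves.JacobiThetaNull.theta2 τ := by
  rw [Literature.NumberTheory.EllipticCurves.JacobiThetaNull.theta2, jacobiTheta₂, ← tsum_mul_left]
  refine tsum_congr fun k => ?_
  rw [cexp_pi_I_mul_add_sq]
  congr 1
  · congr 1
    push_cast
    ring
  · congr 1
    push_cast
    ring

/-! ### The integer lattice `Λₙ = ℤⁿ ⊂ EuclideanSpace ℝ (Fin n)` -/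

section IntegerLattice

variable (n : ℕ)

/-- Coordinates characterise `ℤⁿ`: `x ∈ Λₙ` iff every coordinate of `x` is an integer.
[folklore] -/
theorem mem_span_euclideanBasisFun_iff (x : EuclideanSpace ℝ (Fin n)) :
    x ∈ span ℤ (Set.range (EuclideanSpace.basisFun (Fin n) ℝ).toBasis) ↔
      ∀ i, ∃ k : ℤ, (k : ℝ) = x i := by
  rw [Basis.mem_span_iff_repr_mem]
  refine forall_congr' fun i => ?_
  rw [OrthonormalBasis.coe_toBasis_repr_apply, EuclideanSpace.basisFun_repr]
  rfl

/-- The lattice vector with integer coordinates `m`. [folklore] -/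
theorem toLp_intCast_mem_span_basisFun (m : Fin n → ℤ) :
    (WithLp.toLp 2 fun i => (m i : ℝ)) ∈
      span ℤ (Set.range (EuclideanSpace.basisFun (Fin n) ℝ).toBasis) :=
  (mem_span_euclideanBasisFun_iff n _).mpr fun i => ⟨m i, rfl⟩

/-- The `ℤ`-basis coordinates of `Λₙ` are the Euclidean coordinates: the lattice vector with
coordinates `m` in the basis `(e_i)|_{Λₙ}` is `(m_i)_i`. [folklore] -/
theorem coe_equivFun_symm_eq_toLp (m : Fin n → ℤ) :
    ((((EuclideanSpace.basisFun (Fin n) ℝ).toBasis.restrictScalars ℤ).equivFun.symm m :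
        span ℤ (Set.range (EuclideanSpace.basisFun (Fin n) ℝ).toBasis)) :
          EuclideanSpace ℝ (Fin n)) = WithLp.toLp 2 fun i => (m i : ℝ) := by
  set x := ((EuclideanSpace.basisFun (Fin n) ℝ).toBasis.restrictScalars ℤ).equivFun.symm m
    with hx
  have hrepr : ∀ i, ((EuclideanSpace.basisFun (Fin n) ℝ).toBasis.restrictScalars ℤ).repr x i =
      m i := fun i => by
    rw [← Basis.equivFun_apply, hx, LinearEquiv.apply_symm_apply]
  ext i
  change (x : EuclideanSpace ℝ (Fin n)) i = ((m i : ℤ) : ℝ)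
  rw [← hrepr i]
  have h := (EuclideanSpace.basisFun (Fin n) ℝ).toBasis.restrictScalars_repr_apply ℤ x i
  rw [OrthonormalBasis.coe_toBasis_repr_apply, EuclideanSpace.basisFun_repr] at h
  rw [← h]
  rfl

/-- **Sums over `ℤⁿ` in coordinates**: `∑_{x ∈ Λₙ} G(x) = ∑_{m ∈ ℤⁿ} G((mᵢ)ᵢ)`. [folklore] -/
theorem tsum_span_basisFun_eq_tsum_pi {G : EuclideanSpace ℝ (Fin n) → ℂ} :
    ∑' x : span ℤ (Set.range (EuclideanSpace.basisFun (Fin n) ℝ).toBasis), G x =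
      ∑' m : Fin n → ℤ, G (WithLp.toLp 2 fun i => (m i : ℝ)) := by
  rw [←
    (((EuclideanSpace.basisFun (Fin n) ℝ).toBasis.restrictScalars ℤ).equivFun.symm.toEquiv).tsum_eq]
  refine tsum_congr fun m => ?_
  rw [LinearEquiv.coe_toEquiv, coe_equivFun_symm_eq_toLp]

/-- `‖(mᵢ + uᵢ)ᵢ‖² = ∑ᵢ (mᵢ + uᵢ)²` in `EuclideanSpace ℝ (Fin n)`. [folklore] -/
theorem norm_toLp_intCast_add_sq (m : Fin n → ℤ) (u : EuclideanSpace ℝ (Fin n)) :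
    ‖(WithLp.toLp 2 fun i => (m i : ℝ)) + u‖ ^ 2 = ∑ i, ((m i : ℝ) + u i) ^ 2 := by
  rw [EuclideanSpace.norm_sq_eq]
  refine Finset.sum_congr rfl fun i _ => ?_
  rw [Real.norm_eq_abs, sq_abs]
  rfl

/-- **Integrality of `ℤⁿ`**: `‖x‖² = ∑ᵢ mᵢ² ∈ ℤ` for `x = (mᵢ) ∈ Λₙ`. [folklore] -/
theorem norm_toLp_intCast_sq (m : Fin n → ℤ) :
    ‖(WithLp.toLp 2 fun i => (m i : ℝ) : EuclideanSpace ℝ (Fin n))‖ ^ 2 =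
      ((∑ i, m i ^ 2 : ℤ) : ℝ) := by
  have h := norm_toLp_intCast_add_sq n m 0
  rw [add_zero] at h
  rw [h]
  push_cast
  refine Finset.sum_congr rfl fun i _ => ?_
  simp

/-- Every vector of `Λₙ` has integral square length. [folklore] -/
theorem exists_norm_sq_eq_intCast_of_mem
    (x : span ℤ (Set.range (EuclideanSpace.basisFun (Fin n) ℝ).toBasis)) :
    ∃ k : ℤ, ‖(x : EuclideanSpace ℝ (Fin n))‖ ^ 2 = k := by
  obtain ⟨m, rfl⟩ :=
    ((EuclideanSpace.basisFun (Fin n) ℝ).toBasis.restrictScalars ℤ).equivFun.symm.surjective x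
  exact ⟨∑ i, m i ^ 2, by rw [coe_equivFun_symm_eq_toLp, norm_toLp_intCast_sq]⟩

/-- Inner products on `ℤⁿ` in coordinates: `⟨(mᵢ), (kᵢ)⟩ = ∑ᵢ mᵢ kᵢ`. [folklore] -/
theorem inner_toLp_intCast (m k : Fin n → ℤ) :
    ⟪(WithLp.toLp 2 fun i => (m i : ℝ) : EuclideanSpace ℝ (Fin n)),
      WithLp.toLp 2 fun i => (k i : ℝ)⟫ = ((∑ i, m i * k i : ℤ) : ℝ) := by
  rw [EuclideanSpace.inner_toLp_toLp]
  push_cast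
  refine Finset.sum_congr rfl fun i _ => ?_
  simp [mul_comm]

/-- **`ℤⁿ` is self-dual**: `Λₙ* = Λₙ` (Conway–Sloane Ch. 4 §5: "`ℤⁿ` … is self-dual").
[cite: ConwaySloane1999, Ch. 4 §5] -/
theorem dualLattice_span_basisFun :
    dualLattice (span ℤ (Set.range (EuclideanSpace.basisFun (Fin n) ℝ).toBasis)) =
      span ℤ (Set.range (EuclideanSpace.basisFun (Fin n) ℝ).toBasis) := by
  ext x
  rw [mem_dualLattice, mem_span_euclideanBasisFun_iff]
  constructor
  · intro h i
    obtain ⟨k, hk⟩ := h _ (toLp_intCast_mem_span_basisFun n (Pi.single i 1))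
    refine ⟨k, ?_⟩
    rw [hk, EuclideanSpace.inner_eq_star_dotProduct]
    simp [dotProduct, Pi.single_apply]
  · intro h y hy
    obtain ⟨m, hm⟩ :=
      ((EuclideanSpace.basisFun (Fin n) ℝ).toBasis.restrictScalars ℤ).equivFun.symm.surjective
        ⟨y, hy⟩
    have hy' : y = WithLp.toLp 2 fun i => (m i : ℝ) := by
      rw [← coe_equivFun_symm_eq_toLp n m, hm]
    choose k hk using h
    have hx : x = WithLp.toLp 2 fun i => (k i : ℝ) := by
      ext i; exact (hk i).symm
    refine ⟨∑ i, k i * m i, ?_⟩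
    rw [hx, hy', inner_toLp_intCast]

end IntegerLattice

/-! ### Self-dual lattices have covolume one -/

section Covolume

variable {V : Type*} [NormedAddCommGroup V] [InnerProductSpace ℝ V] [FiniteDimensional ℝ V]
  [MeasurableSpace V] [BorelSpace V] (Γ : Submodule ℤ V) [DiscreteTopology Γ] [IsZLattice ℝ Γ]

/-- **A self-dual lattice is unimodular**: if `Γ* = Γ` then `vol(V/Γ) = 1`, since
`vol(V/Γ*) = vol(V/Γ)⁻¹` (`covolume_dualLattice_holds`; Conway–Sloane Ch. 1 §1.4 and Ch. 2 §2.4: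
`det Λ* = (det Λ)⁻¹`, and a unimodular = self-dual lattice has determinant `1`).
[cite: ConwaySloane1999, Ch. 2 §2.4] -/
theorem covolume_eq_one_of_dualLattice_eq (h : dualLattice Γ = Γ) : ZLattice.covolume Γ = 1 := by
  have hd : ZLattice.covolume (dualLattice Γ) = (ZLattice.covolume Γ)⁻¹ :=
    covolume_dualLattice_holds Γ
  have hpos : 0 < ZLattice.covolume Γ := ZLattice.covolume_pos Γ MeasureTheory.volume
  have heq : ZLattice.covolume (dualLattice Γ) = ZLattice.covolume Γ := by
    simp_rw [h]
  rw [heq] at hd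
  -- `c = c⁻¹`, `c > 0` ⇒ `c = 1`
  have h1 : ZLattice.covolume Γ * ZLattice.covolume Γ = 1 := by
    nth_rewrite 2 [hd]
    exact mul_inv_cancel₀ hpos.ne'
  have h2 : (ZLattice.covolume Γ - 1) * (ZLattice.covolume Γ + 1) = 0 := by
    ring_nf
    linarith
  rcases mul_eq_zero.mp h2 with h3 | h3
  · linarith
  · linarith

end Covolume

/-- `vol(ℝⁿ/ℤⁿ) = 1`. [folklore] -/
theorem covolume_span_basisFun (n : ℕ) :
    ZLattice.covolume (span ℤ (Set.range (EuclideanSpace.basisFun (Fin n) ℝ).toBasis)) = 1 :=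
  covolume_eq_one_of_dualLattice_eq _ (dualLattice_span_basisFun n)

/-! ### Theta series of `ℤⁿ + u` as products -/

section Theta

variable (n : ℕ)

/-- **The theta series of `ℤⁿ + u` factorises over the coordinates**:
`∑_{x ∈ Λₙ} e^{πiτ‖x+u‖²} = ∏ᵢ ∑_{k ∈ ℤ} e^{πiτ(k+uᵢ)²}` for `Im τ > 0` (`‖x+u‖² = ∑ᵢ (xᵢ+uᵢ)²`
and Fubini; Conway–Sloane Ch. 4 §5 and (44) for `u ∈ {0, ½}ⁿ`).
[cite: ConwaySloane1999, Ch. 4 §5 (44)] -/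
theorem tsum_cexp_span_basisFun_eq_prod {τ : ℂ} (hτ : 0 < τ.im) (u : EuclideanSpace ℝ (Fin n)) :
    ∑' x : span ℤ (Set.range (EuclideanSpace.basisFun (Fin n) ℝ).toBasis),
        cexp ((π : ℂ) * I * τ * ((‖(x : EuclideanSpace ℝ (Fin n)) + u‖ ^ 2 : ℝ) : ℂ)) =
      ∏ i : Fin n, ∑' k : ℤ, cexp ((π : ℂ) * I * τ * (((k + u i) ^ 2 : ℝ) : ℂ)) := by
  rw [tsum_span_basisFun_eq_tsum_pi n
      (G := fun v => cexp ((π : ℂ) * I * τ * ((‖v + u‖ ^ 2 : ℝ) : ℂ))),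
    ← tsum_prod_eq_prod_tsum fun i => summable_norm_cexp_pi_I_mul_add_sq hτ (u i)]
  refine tsum_congr fun m => ?_
  rw [norm_toLp_intCast_add_sq, ← Complex.exp_sum]
  congr 1
  push_cast
  rw [Finset.mul_sum]

/-- **`Θ_{ℤⁿ}(τ) = θ₃(τ)ⁿ`** (Conway–Sloane Ch. 4 §5: "The theta series of `ℤⁿ` is `θ₃(z)ⁿ`",
the case `a = n` of (44)). [cite: ConwaySloane1999, Ch. 4 §5 (44)] -/
theorem tsum_cexp_span_basisFun_eq_theta3_pow {τ : ℂ} (hτ : 0 < τ.im) :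
    ∑' x : span ℤ (Set.range (EuclideanSpace.basisFun (Fin n) ℝ).toBasis),
        cexp ((π : ℂ) * I * τ * ((‖(x : EuclideanSpace ℝ (Fin n))‖ ^ 2 : ℝ) : ℂ)) =
      Literature.NumberTheory.EllipticCurves.JacobiThetaNull.theta3 τ ^ n := by
  have h := tsum_cexp_span_basisFun_eq_prod n hτ 0
  simp only [add_zero, WithLp.ofLp_zero, Pi.zero_apply] at h
  rw [h, ← tsum_cexp_pi_I_mul_sq_eq_theta3, Finset.prod_const, Finset.card_univ, Fintype.card_fin]

/-- **`Θ_{ℤⁿ}(τ) ≠ 0` on the upper half plane** (`θ₃` has no zeros in `ℍ`, the tree's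
`theta3_ne_zero`, from `(θ₂θ₃θ₄)⁸ = 2⁸Δ`). [folklore] -/
theorem tsum_cexp_span_basisFun_ne_zero {τ : ℂ} (hτ : 0 < τ.im) :
    ∑' x : span ℤ (Set.range (EuclideanSpace.basisFun (Fin n) ℝ).toBasis),
        cexp ((π : ℂ) * I * τ * ((‖(x : EuclideanSpace ℝ (Fin n))‖ ^ 2 : ℝ) : ℂ)) ≠ 0 := by
  rw [tsum_cexp_span_basisFun_eq_theta3_pow n hτ]
  exact pow_ne_zero _ (Literature.NumberTheory.Automorphic.ModularLambda.theta3_ne_zero hτ)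

/-- **`Θ_{ℤⁿ + ½𝟙}(τ) = θ₂(τ)ⁿ`**: the theta series of the translate of `ℤⁿ` by half the
vector `𝟙 = (1, …, 1)` (Conway–Sloane Ch. 4 §5 (44) with `a = 0`: "the theta series of the translate
`ℤⁿ + (0^a ½^{n-a})` is `θ₂(z)^{n-a} θ₃(z)^a`", with §4.1 (8): `θ₂(z) = ∑_{m ∈ ℤ+1/2} q^{m²}`; in
Elkies' argument `𝟙` is a characteristic vector of `ℤⁿ` and this is `θ_{ℤⁿ}` at the cusp `1`).
[cite: ConwaySloane1999, Ch. 4 §5 (44)] -/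
theorem tsum_cexp_span_basisFun_half_eq_theta2_pow {τ : ℂ} (hτ : 0 < τ.im) :
    ∑' x : span ℤ (Set.range (EuclideanSpace.basisFun (Fin n) ℝ).toBasis),
        cexp ((π : ℂ) * I * τ *
          ((‖(x : EuclideanSpace ℝ (Fin n)) + WithLp.toLp 2 (fun _ => (1 / 2 : ℝ))‖ ^ 2 : ℝ) : ℂ)) =
      Literature.NumberTheory.EllipticCurves.JacobiThetaNull.theta2 τ ^ n := by
  rw [tsum_cexp_span_basisFun_eq_prod n hτ]
  change ∏ _i : Fin n, ∑' k : ℤ, cexp ((π : ℂ) * I * τ * (((k + (1 / 2 : ℝ)) ^ 2 : ℝ) : ℂ)) = _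
  rw [tsum_cexp_pi_I_mul_add_half_sq_eq_theta2, Finset.prod_const, Finset.card_univ,
    Fintype.card_fin]

/-- `‖½𝟙‖`-bookkeeping: `‖𝟙‖² = n` for `𝟙 = (1, …, 1) ∈ ℤⁿ`. [folklore] -/
theorem norm_ones_sq :
    ‖(WithLp.toLp 2 fun _ : Fin n => ((1 : ℤ) : ℝ) : EuclideanSpace ℝ (Fin n))‖ ^ 2 = n := by
  rw [norm_toLp_intCast_sq]
  simp

/-- **`𝟙` is a characteristic vector of `ℤⁿ`**: `⟨𝟙, x⟩ ≡ ‖x‖² (mod 2)` for `x ∈ ℤⁿ`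
(`∑ mᵢ ≡ ∑ mᵢ²` since `m ≡ m²`). [folklore] -/
theorem even_sum_sub_sum_sq (m : Fin n → ℤ) : Even (∑ i, (1 : ℤ) * m i - ∑ i, m i ^ 2) := by
  rw [← Finset.sum_sub_distrib]
  refine Finset.even_sum _ fun i _ => ?_
  rw [one_mul, show m i - m i ^ 2 = -(m i * (m i - 1)) by ring, even_neg]
  exact Int.even_mul_pred_self (m i)

end Theta

end Literature.Algebra.EuclideanLattices

end
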